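import Mathlib
import Summits.ValiantsHypothesis.ValiantsHypothesis.Theorems.DivisionGapPerMultiplesHardExtraction
import Summits.ValiantsHypothesis.ValiantsHypothesis.Theorems.DivisionGapPerMultiplesHardOrderedFactor
import Summits.ValiantsHypothesis.ValiantsHypothesis.Theorems.DivisionGapPerMultiplesHardRichHostOfSquareBlock

/-!
# `DivisionGap.PerMultiplesHard` (stmt-ValiantsHypothesis-5068), line `uncharged-face-walk`:
the RICH-HOST COMPLETE-CLASS RUNG, unconditional (lead c9, cycle 9)

`stub_richSquareBlock` (c7's structure target): every rich host `G ⊆ [n]²` (`n! ≤ Kⁿ·#PM(G)`) has a σ-square block of linear size with a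
cyclic order whose shifted intersection carries a linear regular factor — `Extraction.stub_quasiRandomSquareBlock` (lead c9) ∘
`OrderedFactor.stub_orderedFactor` (lead c8).  `richHostCompleteClassHard`: hence (`RichHostOfSquareBlock.richHost_of_squareBlock`, lead c7)
every COMPLETE CLASS of torus-homogeneous cofactors with balanced, `n`-close margins of offset `≥ 3n³` on a RICH host is exponentially
hard: `2^{⌊n/d⌋} ≤ L⁺(per_G · t)` for `n ≥ n₀(K)`, `d = d(K)`.  This closes the complete-class sub-programme of the line (crux NOTES §C–§K);
both statements are the skeleton's, with `pmCount`/`facePer` written out. [folklore]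
-/

noncomputable section

-- `Summit.ValiantsHypothesis.ValiantsHypothesis.…` is the tree's mandated layout (Sub = Summit).
set_option linter.dupNamespace false

open Finset MvPolynomial Literature.Computability.AlgebraicComplexity
open scoped NNReal BigOperators

namespace Summit.ValiantsHypothesis.ValiantsHypothesis.Theorems.DivisionGap.PerMultiplesHard.RichHostCompleteClass

/-- **stub_richSquareBlock (c7's structure target, now a theorem).**  For every richness scale `K` there are `Cf, n₀` such that every rich host
`G ⊆ [n]²` (`n! ≤ Kⁿ·#PM(G)`, `n ≥ n₀`) has a perfect matching `σ ⊆ G`, a block `A × B` with `σ(B) = A` of size `a ≥ n/Cf`, enumerations `eA, eB`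
(the cyclic order on `A` is `eA ∘ finRotate ∘ eA⁻¹`) and an `f`-regular `Y'` on the `a`-board, `f ≥ a/Cf`, every cell of which lies in the transported
block host together with its shift.  PROOF: the quasi-random σ-square block of `Extraction.stub_quasiRandomSquareBlock` re-enumerated by the order `ρ` of
`OrderedFactor.stub_orderedFactor` (`ρ.trans eA`). [folklore] -/
theorem stub_richSquareBlock :
    ∀ K : ℕ, 1 ≤ K → ∃ Cf n₀ : ℕ, 1 ≤ Cf ∧ ∀ n ≥ n₀, ∀ G : Finset (Fin n × Fin n),
      n.factorial ≤ K ^ n * ((Finset.univ : Finset (Equiv.Perm (Fin n))).filter (fun σ => ∀ i, (σ i, i) ∈ G)).card →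
      ∃ (a : ℕ) (A B : Finset (Fin n)) (eA : Fin a ≃ {x // x ∈ A}) (eB : Fin a ≃ {x // x ∈ B})
        (σ : Equiv.Perm (Fin n)) (Y' : Finset (Fin a × Fin a)) (f : ℕ),
        n ≤ Cf * a ∧ (∀ i, (σ i, i) ∈ G) ∧ (∀ i, σ i ∈ A ↔ i ∈ B) ∧ 1 ≤ f ∧ a ≤ Cf * f ∧
        (∀ e ∈ Y', ((eA e.1 : Fin n), (eB e.2 : Fin n)) ∈ G ∧
          ((eA ((finRotate a).symm e.1) : Fin n), (eB e.2 : Fin n)) ∈ G) ∧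
        (∀ x : Fin a, (Finset.univ.filter fun y : Fin a => (x, y) ∈ Y').card = f) ∧
        (∀ y : Fin a, (Finset.univ.filter fun x : Fin a => (x, y) ∈ Y').card = f) := by
  classical
  intro K hK
  obtain ⟨D₁, D₂, hD₁, hD₂, hX⟩ := Extraction.stub_quasiRandomSquareBlock K hK
  obtain ⟨D₃, E, Cf', a₀, hD₃, hE, hCf', hOF⟩ := OrderedFactor.stub_orderedFactor D₁ D₂ hD₁ hD₂
  obtain ⟨Cf, n₀, hCf, hG⟩ := hX D₃ E hD₃ hE
  refine ⟨Cf * Cf', n₀ + Cf * a₀, le_trans hCf (Nat.le_mul_of_pos_right _ hCf'), ?_⟩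
  intro n hn G hrich
  obtain ⟨a, A, B, eA, eB, σ, X, c₂, c₄, hna, hσG, hσAB, hXG, hr, hc, hc₂, hc₂a, hdev₂, hdev₄, hc₄, hbad⟩ :=
    hG n (by omega) G hrich
  have ha₀ : a₀ ≤ a := by
    by_contra h
    have h1 : Cf * a < Cf * a₀ := Nat.mul_lt_mul_of_pos_left (lt_of_not_ge h) hCf
    omega
  obtain ⟨ρ, Y', f, hf1, haf, hY'H, hYrow, hYcol⟩ := hOF a ha₀ X c₂ c₄ hr hc hc₂ hc₂a hdev₂ hdev₄ hc₄ hbad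
  refine ⟨a, A, B, ρ.trans eA, eB, σ, Y', f, ?_, hσG, hσAB, hf1, ?_, ?_, hYrow, hYcol⟩
  · calc n ≤ Cf * a := hna
      _ ≤ Cf * Cf' * a := by
          rw [Nat.mul_assoc]; exact Nat.mul_le_mul_left _ (Nat.le_mul_of_pos_left _ hCf')
  · calc a ≤ Cf' * f := haf
      _ ≤ Cf * Cf' * f := by
          rw [Nat.mul_assoc]; exact Nat.le_mul_of_pos_left _ hCf
  · intro e he
    have hmem := (Finset.mem_filter.mp (hY'H he)).2
    exact ⟨(hXG _).mp hmem.1, (hXG _).mp hmem.2⟩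

/-- **richHostCompleteClassHard — the rich-host complete-class rung, UNCONDITIONAL (lead c7 modulo the structure target; lead c9 closes it).**
For every richness scale `K ≥ 1` there are `d, n₀` such that for `n ≥ n₀`: if the host `G ⊆ [n]²` is RICH (`n! ≤ Kⁿ·#PM(G)`), `t` is
torus-homogeneous with margins `(R, C)`, COMPLETE on `G` (every `G`-supported table with margins `(R;C)` is an exponent), some such table exists, the
margins are balanced, `n`-close (`|R_i − C_j| ≤ n`) and of offset `≥ 3n³`, then `2^{⌊n/d⌋} ≤ L⁺(per_G · t)` (`per_G` = the face permanent of `G`;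
`d ≥ 1` is recorded so that consumers can invert the bound).
PROOF: `stub_richSquareBlock` feeds `RichHostOfSquareBlock.richHost_of_squareBlock` (block-slice descent + small-window relative spread jaw). [folklore] -/
theorem richHostCompleteClassHard :
    ∀ K : ℕ, 1 ≤ K → ∃ d n₀ : ℕ, 1 ≤ d ∧ ∀ n ≥ n₀, ∀ (G : Finset (Fin n × Fin n))
      (t : MvPolynomial (Fin n × Fin n) ℝ≥0) (R C : Fin n → ℕ),
      n.factorial ≤ K ^ n * ((Finset.univ : Finset (Equiv.Perm (Fin n))).filter (fun σ => ∀ i, (σ i, i) ∈ G)).card →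
      (∀ m ∈ t.support, (∀ i, ∑ j, m (i, j) = R i) ∧ (∀ j, ∑ i, m (i, j) = C j)) →
      (∀ M : (Fin n × Fin n) →₀ ℕ, M.support ⊆ G →
        (∀ i, ∑ j, M (i, j) = R i) → (∀ j, ∑ i, M (i, j) = C j) → M ∈ t.support) →
      (∃ M : (Fin n × Fin n) →₀ ℕ, M.support ⊆ G ∧ (∀ i, ∑ j, M (i, j) = R i) ∧ (∀ j, ∑ i, M (i, j) = C j)) →
      ∑ i, R i = ∑ j, C j →
      (∀ i j, R i ≤ C j + n ∧ C j ≤ R i + n) →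
      (∀ i, 3 * n ^ 3 ≤ R i) →
      2 ^ (n / d) ≤ complexity ((∑ σ ∈ (Finset.univ : Finset (Equiv.Perm (Fin n))).filter (fun σ => ∀ i, (σ i, i) ∈ G),
            monomial (permMonomial σ) (1 : ℝ≥0)) * t) := by
  classical
  intro K hK
  obtain ⟨Cf, n₁, hCf, hstruct⟩ := stub_richSquareBlock K hK
  obtain ⟨n₂, hmain⟩ := RichHostOfSquareBlock.richHost_of_squareBlock Cf hCf
  refine ⟨Cf * (1024 * Cf), n₁ + n₂, Nat.one_le_iff_ne_zero.mpr (by positivity), ?_⟩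
  intro n hn G t R C hrich ht hcomp hex hbal hclose hoff
  obtain ⟨a, A, B, eA, eB, σ, Y', f, hna, hσG, hσAB, hf1, haf, hY', hYrow, hYcol⟩ := hstruct n (by omega) G hrich
  exact hmain n (by omega) G t R C ht hcomp hex hbal hclose hoff a A B eA eB σ Y' f hna hσG hσAB hf1 haf hY' hYrow hYcol

end Summit.ValiantsHypothesis.ValiantsHypothesis.Theorems.DivisionGap.PerMultiplesHard.RichHostCompleteClass
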